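import Literature.Geometry.Manifold.SmoothEmbeddingInverse
import HarnessLib

/-!
# Fibrewise reparametrisation of a tube

General differential topology (topic `Geometry/Manifold`; everything PROVED, no definitions).
In the assembly of the tube of the genus-2 surface `Σ̄₂ ⊂ T⁴ # ℂℙ²bar` of Akhmedov–Park
(Invent. Math. 181 (2010), §3) the product tubes `T : F × ℝ² → X` of the two sheets are used
with the fibre REPARAMETRISED by a smooth family of local diffeomorphisms of `ℝ²`,
`(p, ṽ) ↦ (p, Θ (p, ṽ))` (rotation and scaling by a framing function, the thin-arc profile of the
braided torus …).  This file records the elementary fact that such a reparametrisation of a smooth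
embedding with open range is again, on the domain `W` of the reparametrisation, a smooth injective
open map with a smooth left inverse on its image — the four inputs of the criterion
`isSmoothEmbedding_of_leftInverse_of_isOpenMap` (`OpenEmbeddingCriterion.lean`) and of the local
patching of the tube of `Σ̄₂`:

* `contMDiffOn_reparam`, `injOn_reparam`, `isOpen_image_reparam`, `exists_inverse_reparam`.

The reparametrisation is given abstractly: `Θ` smooth on the open `W`, with a fibrewise inverse `Λ`
smooth on the open `W′`, `(p, Θ (p, ṽ)) ∈ W′` and `Λ (p, Θ (p, ṽ)) = ṽ` on `W`, and
`(p, Λ (p, v)) ∈ W`, `Θ (p, Λ (p, v)) = v` on `W′`.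

## References

* J. M. Lee, *Introduction to Smooth Manifolds*, 2nd ed. (2013), Prop. 4.22, Prop. 5.2. [LeeSmoothManifolds2013]
* A. Akhmedov, B. D. Park, Invent. Math. 181 (2010), §3. [AkhmedovPark2010]
-/

noncomputable section

open scoped Manifold ContDiff Topology
open Set Function

namespace Literature.Geometry.Manifold

namespace Reparam

/-! ### Topological part (no smooth structure) -/

section Topological

variable {F V X : Type*} [TopologicalSpace F] [TopologicalSpace V]
  {T : F × V → X} {Θ Λ : F × V → V} {W W' : Set (F × V)}

omit [TopologicalSpace F] [TopologicalSpace V] in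
/-- The reparametrised tube is injective on `W` (for `T` injective and `Λ` a fibrewise left
inverse of `Θ` on `W`). [folklore] -/
theorem injOn_reparam (hTi : Injective T) (hΛΘ : ∀ q ∈ W, Λ (q.1, Θ q) = q.2) :
    InjOn (fun q : F × V => T (q.1, Θ q)) W := by
  rintro ⟨p, v⟩ hq ⟨p', v'⟩ hq' h
  obtain ⟨hpp, hΘΘ⟩ := Prod.mk.inj (hTi h)
  simp only at hpp hΘΘ
  subst hpp
  have h1 := hΛΘ _ hq
  have h2 := hΛΘ _ hq'
  simp only at h1 h2
  rw [← h1, ← h2, hΘΘ]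

/-- The fibre reparametrisation `(p, ṽ) ↦ (p, Θ (p, ṽ))` maps open subsets of `W` to open sets: the
image of `O ⊆ W` is `{q ∈ W′ | (q.1, Λ q) ∈ O}`. [folklore] -/
theorem isOpen_image_fibre (hW' : IsOpen W') (hΛc : ContinuousOn Λ W')
    (hΘW : ∀ q ∈ W, (q.1, Θ q) ∈ W') (hΛΘ : ∀ q ∈ W, Λ (q.1, Θ q) = q.2)
    (hΘΛ : ∀ q ∈ W', Θ (q.1, Λ q) = q.2) {O : Set (F × V)} (hO : IsOpen O) (hOW : O ⊆ W) :
    IsOpen ((fun q : F × V => (q.1, Θ q)) '' O) := by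
  have heq : (fun q : F × V => (q.1, Θ q)) '' O = W' ∩ (fun q : F × V => (q.1, Λ q)) ⁻¹' O := by
    ext ⟨p, v⟩
    constructor
    · rintro ⟨⟨p₀, v₀⟩, hq, h⟩
      obtain ⟨rfl, rfl⟩ := Prod.mk.inj h
      refine ⟨hΘW _ (hOW hq), ?_⟩
      show (p₀, Λ (p₀, Θ (p₀, v₀))) ∈ O
      rw [hΛΘ _ (hOW hq)]; exact hq
    · rintro ⟨hq', hqO⟩
      refine ⟨(p, Λ (p, v)), hqO, ?_⟩
      show (p, Θ (p, Λ (p, v))) = (p, v)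
      rw [hΘΛ _ hq']
  rw [heq]
  have hc : ContinuousOn (fun q : F × V => (q.1, Λ q)) W' :=
    continuous_fst.continuousOn.prodMk hΛc
  exact hc.isOpen_inter_preimage hW' hO

end Topological

/-! ### Smooth part -/

variable {EF : Type*} [NormedAddCommGroup EF] [NormedSpace ℝ EF] {HF : Type*} [TopologicalSpace HF]
  {IF : ModelWithCorners ℝ EF HF}
  {V : Type*} [NormedAddCommGroup V] [NormedSpace ℝ V]
  {EX : Type*} [NormedAddCommGroup EX] [NormedSpace ℝ EX] {HX : Type*} [TopologicalSpace HX]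
  {IX : ModelWithCorners ℝ EX HX}
  {F : Type*} [TopologicalSpace F] [ChartedSpace HF F]
  {X : Type*} [TopologicalSpace X] [ChartedSpace HX X]
  {T : F × V → X} {Θ Λ : F × V → V} {W W' : Set (F × V)}

variable (hT : Manifold.IsSmoothEmbedding (IF.prod 𝓘(ℝ, V)) IX ∞ T) (hTo : IsOpen (range T))
  (hW : IsOpen W) (hW' : IsOpen W')
  (hΘ : ContMDiffOn (IF.prod 𝓘(ℝ, V)) 𝓘(ℝ, V) ∞ Θ W)
  (hΛ : ContMDiffOn (IF.prod 𝓘(ℝ, V)) 𝓘(ℝ, V) ∞ Λ W')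
  (hΘW : ∀ q ∈ W, (q.1, Θ q) ∈ W') (hΛΘ : ∀ q ∈ W, Λ (q.1, Θ q) = q.2)
  (hΛW : ∀ q ∈ W', (q.1, Λ q) ∈ W) (hΘΛ : ∀ q ∈ W', Θ (q.1, Λ q) = q.2)

include hT hΘ in
/-- The reparametrised tube `(p, ṽ) ↦ T (p, Θ (p, ṽ))` is smooth on `W`. [folklore] -/
theorem contMDiffOn_reparam :
    ContMDiffOn (IF.prod 𝓘(ℝ, V)) IX ∞ (fun q : F × V => T (q.1, Θ q)) W :=
  hT.contMDiff.comp_contMDiffOn (contMDiff_fst.contMDiffOn.prodMk hΘ)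

include hT hTo hW' hΛ hΘW hΛΘ hΘΛ in
/-- The reparametrised tube maps open subsets of `W` to open sets. [cite: LeeSmoothManifolds2013, Prop. 4.22] -/
theorem isOpen_image_reparam {O : Set (F × V)} (hO : IsOpen O) (hOW : O ⊆ W) :
    IsOpen ((fun q : F × V => T (q.1, Θ q)) '' O) := by
  have heq : (fun q : F × V => T (q.1, Θ q)) '' O = T '' ((fun q : F × V => (q.1, Θ q)) '' O) := by
    rw [image_image]
  rw [heq]
  have hoe : Topology.IsOpenEmbedding T := ⟨hT.isEmbedding, hTo⟩
  exact hoe.isOpenMap _ (isOpen_image_fibre hW' hΛ.continuousOn hΘW hΛΘ hΘΛ hO hOW)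

include hT hΛ hΘW hΛΘ in
/-- A left inverse of the reparametrised tube, smooth on its image: `x ↦ (p, Λ (p, v))` for
`(p, v) = T⁻¹ x`. [cite: LeeSmoothManifolds2013, Prop. 4.22] -/
theorem exists_inverse_reparam [Nonempty F] :
    ∃ Rinv : X → F × V,
      ContMDiffOn IX (IF.prod 𝓘(ℝ, V)) ∞ Rinv ((fun q : F × V => T (q.1, Θ q)) '' W) ∧
      ∀ q ∈ W, Rinv (T (q.1, Θ q)) = q := by
  haveI : Nonempty (F × V) := inferInstance
  have hTi : Injective T := hT.isEmbedding.injective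
  let Rinv : X → F × V := fun x => ((invFun T x).1, Λ (invFun T x))
  have hleft : ∀ q : F × V, invFun T (T q) = q := leftInverse_invFun hTi
  refine ⟨Rinv, ?_, ?_⟩
  · have hsub : (fun q : F × V => T (q.1, Θ q)) '' W ⊆ range T := by
      rintro _ ⟨q, -, rfl⟩; exact ⟨_, rfl⟩
    have hinv : ContMDiffOn IX (IF.prod 𝓘(ℝ, V)) ∞ (invFun T)
        ((fun q : F × V => T (q.1, Θ q)) '' W) :=
      (contMDiffOn_invFun_range hT).mono hsub
    have hmaps : ∀ x ∈ (fun q : F × V => T (q.1, Θ q)) '' W, invFun T x ∈ W' := by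
      rintro _ ⟨q, hq, rfl⟩
      rw [hleft]
      exact hΘW q hq
    exact (contMDiff_fst.comp_contMDiffOn hinv).prodMk (hΛ.comp hinv hmaps)
  · intro q hq
    show ((invFun T (T (q.1, Θ q))).1, Λ (invFun T (T (q.1, Θ q)))) = q
    rw [hleft]
    exact Prod.ext rfl (hΛΘ q hq)

end Reparam

end Literature.Geometry.Manifold
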